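import Summits.QuantumFields.YangMills.Theorems.FluctuationComparisonRegPrIntLOrganTangentLawJClausesOfILaw
import Summits.QuantumFields.YangMills.Theorems.FluctuationComparisonRegPrIntLOrganTangentRelPathWindow
import Summits.QuantumFields.YangMills.Theorems.FluctuationComparisonRegPrIntLOrganTangentFibreWeightSquareIntegrability
import HarnessLib

/-!
# Crux `FluctuationComparisonRegPrIntL` (stmt-QuantumFields-20520, rung R3), PATH-B organ, H-currency cone — (L30) THE KNIT-SIDE FACTS OF THE (I-law) DOCK FROM THE FRAME:
# `hpath` ∕ `hsqpath` of ✓`l1j_of_ilaw` ∕ `l2j_of_ilaw` ∕ `jv3_of_ilaw` ∕ `jv4_of_ilaw` ⟸ the chart∕frame facts of ✓p814778 + square stability (law point in the `θ_j`-window) + `rc` small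

Cell `ym3-torus` (YM ladder rung R3 = continuum `SU(2)` Yang–Mills on the three-torus — a RUNG: NOT d = 4, NOT infinite volume, NOT a mass gap, NOT Clay).
Width seat `ym-ust-20520-w5` (gen 24), `--supports stmt-QuantumFields-20520 --as helper`, count-neutral, no registry ∕ binder ∕ `Lines/` edit, DEFINITION-FREE,
default heartbeats.  Over ✓p814778 `wgt_normalised`, ✓p815882 `integrable_logRatio_mul_wgt_of_squareStability`, ✓(L29) `plaqSmall_relPath∕relSquare`, ✓p817001
`integrable_mul_wNum_of_wgt`.

WHAT (TN-PATH-WINDOW, w5 g24 08:59Z).  The (I-law) dock theorems take KNIT-SIDE integrability ∕ non-zero-mass facts ALONG relational law paths∕squares.  Here they are DERIVED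
from exactly: (frame) the binders of ✓p814778∕✓p815882 (`hρm … hpos`), (stab) SQUARE STABILITY with the LAW point in the FULL `θ_j`-window and the VALUE point in the `θ_j∕4`
window — `hstabW : ∀ U Xw, PlaqSmall (θ_j∕4) U → PlaqSmall θ_j Xw → ∀ z, mwCut(Φ(Xw,z)) ≠ 0 → ∀ p, dist1 (plaqHol (Φ (U, z)) p) ≤ c·θBal_Ts` (`c < 1`; one line from a
window-to-window displacement letter `Dw` quantified over `θ_j`-window law points + `hχsupp` + room — the WIDENED (I-geo-w)), and (rc) `(1 + 16·√3·rc)·(θ_j∕4) ≤ θ_j`.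
★`hstabW_of_hglobW` (§0: `hstabW` from the widened `hglob` + `hχsupp` + room — g29 №6 v0.3 «W»),
★`hpath_l1j_of_frame`, ★`hsqpath_l2j_of_frame`, ★`hpath_jv3_of_frame`, ★`hsqpath_jv4_of_frame` conclude the four knit-side hypothesis texts VERBATIM (products `Δ·`, `S·`,
`Δ·S·wNum` by `±` of the `F`- and `F²`-integrabilities of ✓p815882; `F·F` from `F ^ 2`).  So the discharge knit's law lines are
`exact l1j_of_ilaw … (hpath_l1j_of_frame …) hIlawX` etc., with NO integrability binder left in the row.

HONEST FRAMING: bookkeeping [folklore]; square stability and the (I-law) blocks are HYPOTHESES; nothing of Bałaban's analysis is asserted or proved; `SpreadFibreLawH(J)` ∕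
`OrganDischargeInputsHJ` are HYPOTHESIS rows, exactly as open; the five registered stubs of `Lines/semiclassical_s2beta.lean`, crux 20520 and `YM3TorusSU2` are NOT proved; registry
untouched; rung R3 = SU(2) YM₃ on T³ at fixed lattice data — NOT d = 4, NOT infinite volume, NOT a mass gap, NOT Clay; the Yang–Mills mass gap is NOT proved.  [folklore].
-/

set_option autoImplicit false

noncomputable section

namespace Summit.QuantumFields.YangMills.Theorems.OrganTangentILawKnitFacts

open MeasureTheory Filter Topology Set Function
open scoped ENNReal NNReal
open Literature.MathematicalPhysics.QuantumFieldTheory.Balaban1983to89 T3ContinuumYM3Torus T3NestedUnitLaws T3UnitLawDensityEML T4Continuum BalabanUVClass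
  T3UnitScaleTilt T3LevelShift T3TiltDescent
open T4CubeChartExp (expPt)
open Summit.QuantumFields.YangMills.Theorems.FluctuationComparisonRegPrIntLRunpairOrganFibreLaw (mwCut wNum wgt)
open Summit.QuantumFields.YangMills.Theorems.OrganTangentFibreWeightNormalisation (wgt_normalised)
open Summit.QuantumFields.YangMills.Theorems.OrganTangentFibreWeightSquareIntegrability (integrable_logRatio_mul_wgt_of_squareStability)
open Summit.QuantumFields.YangMills.Theorems.OrganTangentLawEdgeIntegrationLip (integrable_mul_wNum_of_wgt)
open Summit.QuantumFields.YangMills.Theorems.OrganTangentRelPathWindow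

/-! ## §0 Square stability in the widened form from the (I-geo-w)ᵂ displacement clause -/

/-- ★ `hstabW` (square stability: LAW point in the `θ_j`-window, VALUE point in the `θ_j∕4`-window) from the WIDENED window-to-window displacement clause `hglobW` of
`OrganDischargeInputsHJ` v0.3 «W» (g29 №6: `hglob`'s LAW binder over `PlaqSmall θBal_j`), the cut's support `hχsupp` at the top level (✓`descendTo_self`) and the room
`24∕25·θBal_Ts + Dw ≤ c·θBal_Ts` — exactly ✓p816800's internal chain, exported for the (I-law) dock. [folklore] -/
theorem hstabW_of_hglobW (F : T3Family) (γ b₀ p₀ : ℝ) (j Ts : ℕ) (hjTs : j + 1 ≤ Ts)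
    (hχsupp : ∀ U, mwCut F γ b₀ p₀ j Ts U ≠ 0 → ∀ (n : ℕ) (hjn : j + 1 ≤ n) (hnK : n ≤ Ts), PlaqSmall (24 / 25 * θBal F.L γ b₀ p₀ n) (descendTo F ℰp n Ts hnK U))
    {Z : Type} (Φ : GaugeField (F.P j) 0 ↥(Matrix.specialUnitaryGroup (Fin 2) ℂ) × Z → GaugeField (F.P Ts) 0 ↥(Matrix.specialUnitaryGroup (Fin 2) ℂ)) (c Dw : ℝ)
    (hroom : 24 / 25 * θBal F.L γ b₀ p₀ Ts + Dw ≤ c * θBal F.L γ b₀ p₀ Ts)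
    (hglobW : ∀ z (U U' : GaugeField (F.P j) 0 ↥(Matrix.specialUnitaryGroup (Fin 2) ℂ)), PlaqSmall (θBal F.L γ b₀ p₀ j) U → PlaqSmall (θBal F.L γ b₀ p₀ j / 4) U' →
      ∀ p, dist1 (GaugeField.plaqHol (Φ (U', z)) p) ≤ dist1 (GaugeField.plaqHol (Φ (U, z)) p) + Dw) :
    ∀ (U Xw : GaugeField (F.P j) 0 ↥(Matrix.specialUnitaryGroup (Fin 2) ℂ)), PlaqSmall (θBal F.L γ b₀ p₀ j / 4) U → PlaqSmall (θBal F.L γ b₀ p₀ j) Xw →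
      ∀ z, mwCut F γ b₀ p₀ j Ts (Φ (Xw, z)) ≠ 0 → ∀ p, dist1 (GaugeField.plaqHol (Φ (U, z)) p) ≤ c * θBal F.L γ b₀ p₀ Ts := by
  intro U Xw hU hXw z hχ p
  have htop : PlaqSmall (24 / 25 * θBal F.L γ b₀ p₀ Ts) (Φ (Xw, z)) := by
    intro q
    have h := hχsupp _ hχ Ts hjTs le_rfl q
    rw [T3DescentFibreTower.descendTo_self] at h
    exact h
  have h1 := hglobW z Xw U hXw hU p
  have h2 := htop p
  linarith

/-- The row's head smallness `√3·rc ≤ 3∕16` (`OrganDischargeInputsHJ` v0.3b, LEAD №35 (B)) gives the window guard `(1 + 16·√3·rc)·(θ_j∕4) ≤ θ_j` used below. [folklore] -/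
theorem hrc_of_sqrt3_mul_le {rc θ : ℝ} (h : Real.sqrt 3 * rc ≤ 3 / 16) (hθ : 0 ≤ θ) : (1 + 16 * Real.sqrt 3 * rc) * (θ / 4) ≤ θ := by
  nlinarith

/-! ## §1 One law point: everything the bricks need at a `θ_j`-window law point and a `θ_j∕4`-window value point -/

/-- At a LAW point `Xw` in the `θ_j`-window and a VALUE point `U` in the `θ_j∕4`-window: `Integrable (wNum … t Xw)`, `∫ wNum … t Xw ≠ 0`,
`Integrable (F_U·wNum … t Xw)`, `Integrable (F_U²·wNum … t Xw)` (✓p814778 + ✓p815882 + ✓p817001). [folklore] -/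
theorem lawPoint_facts (F : T3Family) (γ b₀ p₀ : ℝ) (j Ts : ℕ) (hjTs : j + 1 ≤ Ts)
    (ρ ρ' : (i : ℕ) → GaugeField (F.P i) 0 ↥(Matrix.specialUnitaryGroup (Fin 2) ℂ) → ℝ)
    (hρm : Measurable (ρ Ts)) (hρ'm : Measurable (ρ' Ts))
    (hρc : ContinuousOn (ρ Ts) {U | PlaqSmall (θBal F.L γ b₀ p₀ Ts) U}) (hρ'c : ContinuousOn (ρ' Ts) {U | PlaqSmall (θBal F.L γ b₀ p₀ Ts) U})
    (hρpos : ∀ U, PlaqSmall (θBal F.L γ b₀ p₀ Ts) U → 0 < ρ Ts U ∧ 0 < ρ' Ts U)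
    (hθ : 0 < θBal F.L γ b₀ p₀ Ts)
    (hχc : Continuous (mwCut F γ b₀ p₀ j Ts)) (hχ0 : ∀ U, 0 ≤ mwCut F γ b₀ p₀ j Ts U)
    (hχsupp : ∀ U, mwCut F γ b₀ p₀ j Ts U ≠ 0 → ∀ (n : ℕ) (hjn : j + 1 ≤ n) (hnK : n ≤ Ts), PlaqSmall (24 / 25 * θBal F.L γ b₀ p₀ n) (descendTo F ℰp n Ts hnK U))
    (hχpos : ∀ U, (∀ (n : ℕ) (hjn : j + 1 ≤ n) (hnK : n ≤ Ts), PlaqSmall (24 / 25 * θBal F.L γ b₀ p₀ n) (descendTo F ℰp n Ts hnK U)) → 0 < mwCut F γ b₀ p₀ j Ts U)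
    {Z : Type} [MeasurableSpace Z] (τ : Measure Z) [IsProbabilityMeasure τ]
    (Φ : GaugeField (F.P j) 0 ↥(Matrix.specialUnitaryGroup (Fin 2) ℂ) × Z → GaugeField (F.P Ts) 0 ↥(Matrix.specialUnitaryGroup (Fin 2) ℂ))
    (J : GaugeField (F.P j) 0 ↥(Matrix.specialUnitaryGroup (Fin 2) ℂ) × Z → ℝ≥0)
    (hΦm : Measurable Φ) (hJm : Measurable J) (CJ : ℝ) (hJle : ∀ V z, (J (V, z) : ℝ) ≤ CJ)
    (hpos : ∀ V, PlaqSmall (θBal F.L γ b₀ p₀ j) V →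
      0 < ∫⁻ z in {z | (∀ (n : ℕ) (hjn : j + 1 ≤ n) (hnK : n ≤ Ts), PlaqSmall (24 / 25 * θBal F.L γ b₀ p₀ n) (descendTo F ℰp n Ts hnK (Φ (V, z))))},
        (J (V, z) : ℝ≥0∞) ∂τ)
    (c : ℝ) (hc : c < 1)
    (hstabW : ∀ (U Xw : GaugeField (F.P j) 0 ↥(Matrix.specialUnitaryGroup (Fin 2) ℂ)), PlaqSmall (θBal F.L γ b₀ p₀ j / 4) U → PlaqSmall (θBal F.L γ b₀ p₀ j) Xw →
      ∀ z, mwCut F γ b₀ p₀ j Ts (Φ (Xw, z)) ≠ 0 → ∀ p, dist1 (GaugeField.plaqHol (Φ (U, z)) p) ≤ c * θBal F.L γ b₀ p₀ Ts) (t : ℝ)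
    (U Xw : GaugeField (F.P j) 0 ↥(Matrix.specialUnitaryGroup (Fin 2) ℂ)) (hU : PlaqSmall (θBal F.L γ b₀ p₀ j / 4) U) (hXw : PlaqSmall (θBal F.L γ b₀ p₀ j) Xw) :
    Integrable (fun z => wNum F γ b₀ p₀ j Ts ρ ρ' Φ J t Xw z) τ ∧ (∫ z, wNum F γ b₀ p₀ j Ts ρ ρ' Φ J t Xw z ∂τ) ≠ 0 ∧
    Integrable (fun z => (Real.log (ρ Ts (Φ (U, z))) - Real.log (ρ' Ts (Φ (U, z)))) * wNum F γ b₀ p₀ j Ts ρ ρ' Φ J t Xw z) τ ∧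
    Integrable (fun z => ((Real.log (ρ Ts (Φ (U, z))) - Real.log (ρ' Ts (Φ (U, z)))) * (Real.log (ρ Ts (Φ (U, z))) - Real.log (ρ' Ts (Φ (U, z))))) *
      wNum F γ b₀ p₀ j Ts ρ ρ' Φ J t Xw z) τ := by
  obtain ⟨hiW, hmass, -, -⟩ := wgt_normalised F γ b₀ p₀ j Ts hjTs ρ ρ' hρm hρ'm hρc hρ'c hρpos hθ hχc hχ0 hχsupp hχpos τ Φ J hΦm hJm CJ hJle hpos t Xw hXw
  have hZ : (∫ z, wNum F γ b₀ p₀ j Ts ρ ρ' Φ J t Xw z ∂τ) ≠ 0 := hmass.ne'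
  obtain ⟨h1, h2⟩ := integrable_logRatio_mul_wgt_of_squareStability F γ b₀ p₀ j Ts hjTs ρ ρ' hρm hρ'm hρc hρ'c hρpos hθ hχc hχ0 hχsupp hχpos τ Φ J hΦm hJm CJ hJle hpos c hc t U Xw hXw (hstabW U Xw hU hXw)
  refine ⟨hiW, hZ, integrable_mul_wNum_of_wgt F γ b₀ p₀ j Ts ρ ρ' τ Φ J t Xw _ hZ h1, ?_⟩
  have h2' : Integrable (fun z => ((Real.log (ρ Ts (Φ (U, z))) - Real.log (ρ' Ts (Φ (U, z)))) * (Real.log (ρ Ts (Φ (U, z))) - Real.log (ρ' Ts (Φ (U, z))))) *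
      (wgt F γ b₀ p₀ j Ts ρ ρ' τ Φ J t) Xw z) τ := by
    have e : (fun z => ((Real.log (ρ Ts (Φ (U, z))) - Real.log (ρ' Ts (Φ (U, z)))) * (Real.log (ρ Ts (Φ (U, z))) - Real.log (ρ' Ts (Φ (U, z))))) *
        (wgt F γ b₀ p₀ j Ts ρ ρ' τ Φ J t) Xw z)
        = fun z => (Real.log (ρ Ts (Φ (U, z))) - Real.log (ρ' Ts (Φ (U, z)))) ^ 2 * wgt F γ b₀ p₀ j Ts ρ ρ' τ Φ J t Xw z := by
      funext z; ring
    rw [e]; exact h2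
  exact integrable_mul_wNum_of_wgt F γ b₀ p₀ j Ts ρ ρ' τ Φ J t Xw _ hZ h2'

/-- `PlaqSmall` is monotone in the threshold. [folklore] -/
theorem plaqSmall_mono {P : Params} {i : ℕ} {θ₁ θ₂ : ℝ} (h : θ₁ ≤ θ₂) {U : GaugeField P i ↥(Matrix.specialUnitaryGroup (Fin 2) ℂ)} (hU : PlaqSmall θ₁ U) : PlaqSmall θ₂ U :=
  fun p => lt_of_lt_of_le (hU p) h

/-- `s ∈ [0,1] ⟹ |s| ≤ 2`. [folklore] -/
theorem abs_le_two_of_mem_Icc {s : ℝ} (hs : s ∈ Set.Icc (0:ℝ) 1) : |s| ≤ 2 := by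
  rw [abs_le]; constructor <;> linarith [hs.1, hs.2]

/-! ## §2 The four knit-side hypothesis texts of the (I-law) dock -/

/-- ★ `hpath` of ✓`l1j_of_ilaw` from the frame + square stability + `rc` small. [folklore] -/
theorem hpath_l1j_of_frame (F : T3Family) (γ b₀ p₀ : ℝ) (j Ts : ℕ) (hjTs : j + 1 ≤ Ts)
    (ρ ρ' : (i : ℕ) → GaugeField (F.P i) 0 ↥(Matrix.specialUnitaryGroup (Fin 2) ℂ) → ℝ)
    (hρm : Measurable (ρ Ts)) (hρ'm : Measurable (ρ' Ts))
    (hρc : ContinuousOn (ρ Ts) {U | PlaqSmall (θBal F.L γ b₀ p₀ Ts) U}) (hρ'c : ContinuousOn (ρ' Ts) {U | PlaqSmall (θBal F.L γ b₀ p₀ Ts) U})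
    (hρpos : ∀ U, PlaqSmall (θBal F.L γ b₀ p₀ Ts) U → 0 < ρ Ts U ∧ 0 < ρ' Ts U)
    (hθ : 0 < θBal F.L γ b₀ p₀ Ts)
    (hχc : Continuous (mwCut F γ b₀ p₀ j Ts)) (hχ0 : ∀ U, 0 ≤ mwCut F γ b₀ p₀ j Ts U)
    (hχsupp : ∀ U, mwCut F γ b₀ p₀ j Ts U ≠ 0 → ∀ (n : ℕ) (hjn : j + 1 ≤ n) (hnK : n ≤ Ts), PlaqSmall (24 / 25 * θBal F.L γ b₀ p₀ n) (descendTo F ℰp n Ts hnK U))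
    (hχpos : ∀ U, (∀ (n : ℕ) (hjn : j + 1 ≤ n) (hnK : n ≤ Ts), PlaqSmall (24 / 25 * θBal F.L γ b₀ p₀ n) (descendTo F ℰp n Ts hnK U)) → 0 < mwCut F γ b₀ p₀ j Ts U)
    {Z : Type} [MeasurableSpace Z] (τ : Measure Z) [IsProbabilityMeasure τ]
    (Φ : GaugeField (F.P j) 0 ↥(Matrix.specialUnitaryGroup (Fin 2) ℂ) × Z → GaugeField (F.P Ts) 0 ↥(Matrix.specialUnitaryGroup (Fin 2) ℂ))
    (J : GaugeField (F.P j) 0 ↥(Matrix.specialUnitaryGroup (Fin 2) ℂ) × Z → ℝ≥0)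
    (hΦm : Measurable Φ) (hJm : Measurable J) (CJ : ℝ) (hJle : ∀ V z, (J (V, z) : ℝ) ≤ CJ)
    (hpos : ∀ V, PlaqSmall (θBal F.L γ b₀ p₀ j) V →
      0 < ∫⁻ z in {z | (∀ (n : ℕ) (hjn : j + 1 ≤ n) (hnK : n ≤ Ts), PlaqSmall (24 / 25 * θBal F.L γ b₀ p₀ n) (descendTo F ℰp n Ts hnK (Φ (V, z))))},
        (J (V, z) : ℝ≥0∞) ∂τ)
    (c : ℝ) (hc : c < 1) (rc : ℝ) (hθj : 0 ≤ θBal F.L γ b₀ p₀ j)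
    (hrc : (1 + 16 * Real.sqrt 3 * rc) * (θBal F.L γ b₀ p₀ j / 4) ≤ θBal F.L γ b₀ p₀ j) (hrc0 : 0 ≤ rc)
    (hstabW : ∀ (U Xw : GaugeField (F.P j) 0 ↥(Matrix.specialUnitaryGroup (Fin 2) ℂ)), PlaqSmall (θBal F.L γ b₀ p₀ j / 4) U → PlaqSmall (θBal F.L γ b₀ p₀ j) Xw →
      ∀ z, mwCut F γ b₀ p₀ j Ts (Φ (Xw, z)) ≠ 0 → ∀ p, dist1 (GaugeField.plaqHol (Φ (U, z)) p) ≤ c * θBal F.L γ b₀ p₀ Ts) (t : ℝ) :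
    ∀ (B' : PBond (F.P j) 0) (m' : Fin 3 → ℝ) (U₁ V₁ U₂ : GaugeField (F.P j) 0 ↥(Matrix.specialUnitaryGroup (Fin 2) ℂ)) (X : ℝ → GaugeField (F.P j) 0 ↥(Matrix.specialUnitaryGroup (Fin 2) ℂ)), ‖m'‖ ≤ rc * (θBal F.L γ b₀ p₀ j / 4) →
      PlaqSmall (θBal F.L γ b₀ p₀ j / 4) U₁ → PlaqSmall (θBal F.L γ b₀ p₀ j / 4) V₁ → PlaqSmall (θBal F.L γ b₀ p₀ j / 4) U₂ → (∀ s e, e ≠ B' → X s e = U₂ e) → (∀ s, X s B' = U₂ B' * expPt (s • m')) →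
      ∀ s ∈ Set.Icc (0:ℝ) 1, Integrable (fun z => wNum F γ b₀ p₀ j Ts ρ ρ' Φ J t (X s) z) τ ∧ Integrable (fun z => (Real.log (ρ Ts (Φ (U₁, z))) - Real.log (ρ' Ts (Φ (U₁, z)))) * wNum F γ b₀ p₀ j Ts ρ ρ' Φ J t (X s) z) τ ∧
        Integrable (fun z => (Real.log (ρ Ts (Φ (V₁, z))) - Real.log (ρ' Ts (Φ (V₁, z)))) * wNum F γ b₀ p₀ j Ts ρ ρ' Φ J t (X s) z) τ ∧ ∫ z, wNum F γ b₀ p₀ j Ts ρ ρ' Φ J t (X s) z ∂τ ≠ 0 := by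
  intro B' m' U₁ V₁ U₂ X hm' hU₁ hV₁ hU₂ hoff hon s hs
  have hθj4 : 0 ≤ (θBal F.L γ b₀ p₀ j / 4) := by positivity
  have hXw : PlaqSmall (θBal F.L γ b₀ p₀ j) (X s) := by
    have h := plaqSmall_relPath_of_le hU₂ hm' hoff hon (abs_le_two_of_mem_Icc hs)
    refine plaqSmall_mono (le_trans ?_ hrc) h
    have h3 : 0 ≤ Real.sqrt 3 * rc := mul_nonneg (Real.sqrt_nonneg 3) hrc0
    exact mul_le_mul_of_nonneg_right (by nlinarith [h3]) hθj4
  have fU := lawPoint_facts F γ b₀ p₀ j Ts hjTs ρ ρ' hρm hρ'm hρc hρ'c hρpos hθ hχc hχ0 hχsupp hχpos τ Φ J hΦm hJm CJ hJle hpos c hc (hstabW := hstabW) t U₁ (X s) hU₁ hXw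
  have fV := lawPoint_facts F γ b₀ p₀ j Ts hjTs ρ ρ' hρm hρ'm hρc hρ'c hρpos hθ hχc hχ0 hχsupp hχpos τ Φ J hΦm hJm CJ hJle hpos c hc (hstabW := hstabW) t V₁ (X s) hV₁ hXw
  exact ⟨fU.1, fU.2.2.1, fV.2.2.1, fU.2.1⟩


/-- ★ `hsqpath` of ✓`l2j_of_ilaw` from the frame + square stability + `rc` small. [folklore] -/
theorem hsqpath_l2j_of_frame (F : T3Family) (γ b₀ p₀ : ℝ) (j Ts : ℕ) (hjTs : j + 1 ≤ Ts)
    (ρ ρ' : (i : ℕ) → GaugeField (F.P i) 0 ↥(Matrix.specialUnitaryGroup (Fin 2) ℂ) → ℝ)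
    (hρm : Measurable (ρ Ts)) (hρ'm : Measurable (ρ' Ts))
    (hρc : ContinuousOn (ρ Ts) {U | PlaqSmall (θBal F.L γ b₀ p₀ Ts) U}) (hρ'c : ContinuousOn (ρ' Ts) {U | PlaqSmall (θBal F.L γ b₀ p₀ Ts) U})
    (hρpos : ∀ U, PlaqSmall (θBal F.L γ b₀ p₀ Ts) U → 0 < ρ Ts U ∧ 0 < ρ' Ts U)
    (hθ : 0 < θBal F.L γ b₀ p₀ Ts)
    (hχc : Continuous (mwCut F γ b₀ p₀ j Ts)) (hχ0 : ∀ U, 0 ≤ mwCut F γ b₀ p₀ j Ts U)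
    (hχsupp : ∀ U, mwCut F γ b₀ p₀ j Ts U ≠ 0 → ∀ (n : ℕ) (hjn : j + 1 ≤ n) (hnK : n ≤ Ts), PlaqSmall (24 / 25 * θBal F.L γ b₀ p₀ n) (descendTo F ℰp n Ts hnK U))
    (hχpos : ∀ U, (∀ (n : ℕ) (hjn : j + 1 ≤ n) (hnK : n ≤ Ts), PlaqSmall (24 / 25 * θBal F.L γ b₀ p₀ n) (descendTo F ℰp n Ts hnK U)) → 0 < mwCut F γ b₀ p₀ j Ts U)
    {Z : Type} [MeasurableSpace Z] (τ : Measure Z) [IsProbabilityMeasure τ]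
    (Φ : GaugeField (F.P j) 0 ↥(Matrix.specialUnitaryGroup (Fin 2) ℂ) × Z → GaugeField (F.P Ts) 0 ↥(Matrix.specialUnitaryGroup (Fin 2) ℂ))
    (J : GaugeField (F.P j) 0 ↥(Matrix.specialUnitaryGroup (Fin 2) ℂ) × Z → ℝ≥0)
    (hΦm : Measurable Φ) (hJm : Measurable J) (CJ : ℝ) (hJle : ∀ V z, (J (V, z) : ℝ) ≤ CJ)
    (hpos : ∀ V, PlaqSmall (θBal F.L γ b₀ p₀ j) V →
      0 < ∫⁻ z in {z | (∀ (n : ℕ) (hjn : j + 1 ≤ n) (hnK : n ≤ Ts), PlaqSmall (24 / 25 * θBal F.L γ b₀ p₀ n) (descendTo F ℰp n Ts hnK (Φ (V, z))))},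
        (J (V, z) : ℝ≥0∞) ∂τ)
    (c : ℝ) (hc : c < 1) (rc : ℝ) (hθj : 0 ≤ θBal F.L γ b₀ p₀ j)
    (hrc : (1 + 16 * Real.sqrt 3 * rc) * (θBal F.L γ b₀ p₀ j / 4) ≤ θBal F.L γ b₀ p₀ j)
    (hstabW : ∀ (U Xw : GaugeField (F.P j) 0 ↥(Matrix.specialUnitaryGroup (Fin 2) ℂ)), PlaqSmall (θBal F.L γ b₀ p₀ j / 4) U → PlaqSmall (θBal F.L γ b₀ p₀ j) Xw →
      ∀ z, mwCut F γ b₀ p₀ j Ts (Φ (Xw, z)) ≠ 0 → ∀ p, dist1 (GaugeField.plaqHol (Φ (U, z)) p) ≤ c * θBal F.L γ b₀ p₀ Ts) (t : ℝ) :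
    ∀ (B B' : PBond (F.P j) 0) (m m' : Fin 3 → ℝ) (V00 : GaugeField (F.P j) 0 ↥(Matrix.specialUnitaryGroup (Fin 2) ℂ)) (Y : ℝ → GaugeField (F.P j) 0 ↥(Matrix.specialUnitaryGroup (Fin 2) ℂ)) (X : ℝ → ℝ → GaugeField (F.P j) 0 ↥(Matrix.specialUnitaryGroup (Fin 2) ℂ)), ‖m‖ ≤ rc * (θBal F.L γ b₀ p₀ j / 4) → ‖m'‖ ≤ rc * (θBal F.L γ b₀ p₀ j / 4) →
      PlaqSmall (θBal F.L γ b₀ p₀ j / 4) V00 → (∀ s e, e ≠ B → Y s e = V00 e) → (∀ s, Y s B = V00 B * expPt (s • m)) → (∀ s s' e, e ≠ B' → X s s' e = Y s e) → (∀ s s', X s s' B' = Y s B' * expPt (s' • m')) →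
      ∀ s ∈ Set.Icc (0:ℝ) 1, ∀ s' ∈ Set.Icc (0:ℝ) 1, Integrable (fun z => wNum F γ b₀ p₀ j Ts ρ ρ' Φ J t (X s s') z) τ ∧ Integrable (fun z => (Real.log (ρ Ts (Φ (V00, z))) - Real.log (ρ' Ts (Φ (V00, z)))) * wNum F γ b₀ p₀ j Ts ρ ρ' Φ J t (X s s') z) τ ∧ ∫ z, wNum F γ b₀ p₀ j Ts ρ ρ' Φ J t (X s s') z ∂τ ≠ 0 := by
  intro B B' m m' V00 Y X hm hm' hV hYoff hYon hXoff hXon s hs s' hs'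
  have hθj4 : 0 ≤ (θBal F.L γ b₀ p₀ j / 4) := by positivity
  have hXw : PlaqSmall (θBal F.L γ b₀ p₀ j) (X s s') :=
    plaqSmall_mono hrc (plaqSmall_relSquare_of_le hV hm hm' hYoff hYon hXoff hXon (abs_le_two_of_mem_Icc hs) (abs_le_two_of_mem_Icc hs'))
  have f := lawPoint_facts F γ b₀ p₀ j Ts hjTs ρ ρ' hρm hρ'm hρc hρ'c hρpos hθ hχc hχ0 hχsupp hχpos τ Φ J hΦm hJm CJ hJle hpos c hc (hstabW := hstabW) t V00 (X s s') hV hXw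
  exact ⟨f.1, f.2.2.1, f.2.1⟩

/-- ★ `hpath` of ✓`jv3_of_ilaw` (frozen factors `Δ, S, Δ·S` by `±` of the `F`∕`F²` facts). [folklore] -/
theorem hpath_jv3_of_frame (F : T3Family) (γ b₀ p₀ : ℝ) (j Ts : ℕ) (hjTs : j + 1 ≤ Ts)
    (ρ ρ' : (i : ℕ) → GaugeField (F.P i) 0 ↥(Matrix.specialUnitaryGroup (Fin 2) ℂ) → ℝ)
    (hρm : Measurable (ρ Ts)) (hρ'm : Measurable (ρ' Ts))
    (hρc : ContinuousOn (ρ Ts) {U | PlaqSmall (θBal F.L γ b₀ p₀ Ts) U}) (hρ'c : ContinuousOn (ρ' Ts) {U | PlaqSmall (θBal F.L γ b₀ p₀ Ts) U})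
    (hρpos : ∀ U, PlaqSmall (θBal F.L γ b₀ p₀ Ts) U → 0 < ρ Ts U ∧ 0 < ρ' Ts U)
    (hθ : 0 < θBal F.L γ b₀ p₀ Ts)
    (hχc : Continuous (mwCut F γ b₀ p₀ j Ts)) (hχ0 : ∀ U, 0 ≤ mwCut F γ b₀ p₀ j Ts U)
    (hχsupp : ∀ U, mwCut F γ b₀ p₀ j Ts U ≠ 0 → ∀ (n : ℕ) (hjn : j + 1 ≤ n) (hnK : n ≤ Ts), PlaqSmall (24 / 25 * θBal F.L γ b₀ p₀ n) (descendTo F ℰp n Ts hnK U))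
    (hχpos : ∀ U, (∀ (n : ℕ) (hjn : j + 1 ≤ n) (hnK : n ≤ Ts), PlaqSmall (24 / 25 * θBal F.L γ b₀ p₀ n) (descendTo F ℰp n Ts hnK U)) → 0 < mwCut F γ b₀ p₀ j Ts U)
    {Z : Type} [MeasurableSpace Z] (τ : Measure Z) [IsProbabilityMeasure τ]
    (Φ : GaugeField (F.P j) 0 ↥(Matrix.specialUnitaryGroup (Fin 2) ℂ) × Z → GaugeField (F.P Ts) 0 ↥(Matrix.specialUnitaryGroup (Fin 2) ℂ))
    (J : GaugeField (F.P j) 0 ↥(Matrix.specialUnitaryGroup (Fin 2) ℂ) × Z → ℝ≥0)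
    (hΦm : Measurable Φ) (hJm : Measurable J) (CJ : ℝ) (hJle : ∀ V z, (J (V, z) : ℝ) ≤ CJ)
    (hpos : ∀ V, PlaqSmall (θBal F.L γ b₀ p₀ j) V →
      0 < ∫⁻ z in {z | (∀ (n : ℕ) (hjn : j + 1 ≤ n) (hnK : n ≤ Ts), PlaqSmall (24 / 25 * θBal F.L γ b₀ p₀ n) (descendTo F ℰp n Ts hnK (Φ (V, z))))},
        (J (V, z) : ℝ≥0∞) ∂τ)
    (c : ℝ) (hc : c < 1) (rc : ℝ) (hθj : 0 ≤ θBal F.L γ b₀ p₀ j)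
    (hrc : (1 + 16 * Real.sqrt 3 * rc) * (θBal F.L γ b₀ p₀ j / 4) ≤ θBal F.L γ b₀ p₀ j) (hrc0 : 0 ≤ rc)
    (hstabW : ∀ (U Xw : GaugeField (F.P j) 0 ↥(Matrix.specialUnitaryGroup (Fin 2) ℂ)), PlaqSmall (θBal F.L γ b₀ p₀ j / 4) U → PlaqSmall (θBal F.L γ b₀ p₀ j) Xw →
      ∀ z, mwCut F γ b₀ p₀ j Ts (Φ (Xw, z)) ≠ 0 → ∀ p, dist1 (GaugeField.plaqHol (Φ (U, z)) p) ≤ c * θBal F.L γ b₀ p₀ Ts) :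
    ∀ (t : ℝ), 0 ≤ t → t ≤ 1 → ∀ (B' : PBond (F.P j) 0) (m' : Fin 3 → ℝ) (U₁ V₁ U₂ : GaugeField (F.P j) 0 ↥(Matrix.specialUnitaryGroup (Fin 2) ℂ)) (X : ℝ → GaugeField (F.P j) 0 ↥(Matrix.specialUnitaryGroup (Fin 2) ℂ)), ‖m'‖ ≤ rc * (θBal F.L γ b₀ p₀ j / 4) →
      PlaqSmall (θBal F.L γ b₀ p₀ j / 4) U₁ → PlaqSmall (θBal F.L γ b₀ p₀ j / 4) V₁ → PlaqSmall (θBal F.L γ b₀ p₀ j / 4) U₂ → (∀ s e, e ≠ B' → X s e = U₂ e) → (∀ s, X s B' = U₂ B' * expPt (s • m')) →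
      ∀ s ∈ Set.Icc (0:ℝ) 1, Integrable (fun z => wNum F γ b₀ p₀ j Ts ρ ρ' Φ J t (X s) z) τ ∧ Integrable (fun z => ((Real.log (ρ Ts (Φ (V₁, z))) - Real.log (ρ' Ts (Φ (V₁, z)))) - (Real.log (ρ Ts (Φ (U₁, z))) - Real.log (ρ' Ts (Φ (U₁, z))))) * wNum F γ b₀ p₀ j Ts ρ ρ' Φ J t (X s) z) τ ∧
        Integrable (fun z => ((Real.log (ρ Ts (Φ (V₁, z))) - Real.log (ρ' Ts (Φ (V₁, z)))) + (Real.log (ρ Ts (Φ (U₁, z))) - Real.log (ρ' Ts (Φ (U₁, z))))) * wNum F γ b₀ p₀ j Ts ρ ρ' Φ J t (X s) z) τ ∧ Integrable (fun z => (((Real.log (ρ Ts (Φ (V₁, z))) - Real.log (ρ' Ts (Φ (V₁, z)))) - (Real.log (ρ Ts (Φ (U₁, z))) - Real.log (ρ' Ts (Φ (U₁, z))))) * ((Real.log (ρ Ts (Φ (V₁, z))) - Real.log (ρ' Ts (Φ (V₁, z)))) + (Real.log (ρ Ts (Φ (U₁, z))) - Real.log (ρ' Ts (Φ (U₁, z))))))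 * wNum F γ b₀ p₀ j Ts ρ ρ' Φ J t (X s) z) τ ∧ ∫ z, wNum F γ b₀ p₀ j Ts ρ ρ' Φ J t (X s) z ∂τ ≠ 0 := by
  intro t _ _ B' m' U₁ V₁ U₂ X hm' hU₁ hV₁ hU₂ hoff hon s hs
  have hθj4 : 0 ≤ (θBal F.L γ b₀ p₀ j / 4) := by positivity
  have hXw : PlaqSmall (θBal F.L γ b₀ p₀ j) (X s) := by
    have h := plaqSmall_relPath_of_le hU₂ hm' hoff hon (abs_le_two_of_mem_Icc hs)
    refine plaqSmall_mono (le_trans ?_ hrc) h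
    have h3 : 0 ≤ Real.sqrt 3 * rc := mul_nonneg (Real.sqrt_nonneg 3) hrc0
    exact mul_le_mul_of_nonneg_right (by nlinarith [h3]) hθj4
  have fU := lawPoint_facts F γ b₀ p₀ j Ts hjTs ρ ρ' hρm hρ'm hρc hρ'c hρpos hθ hχc hχ0 hχsupp hχpos τ Φ J hΦm hJm CJ hJle hpos c hc (hstabW := hstabW) t U₁ (X s) hU₁ hXw
  have fV := lawPoint_facts F γ b₀ p₀ j Ts hjTs ρ ρ' hρm hρ'm hρc hρ'c hρpos hθ hχc hχ0 hχsupp hχpos τ Φ J hΦm hJm CJ hJle hpos c hc (hstabW := hstabW) t V₁ (X s) hV₁ hXw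
  refine ⟨fU.1, ?_, ?_, ?_, fU.2.1⟩
  · have e : (fun z => ((Real.log (ρ Ts (Φ (V₁, z))) - Real.log (ρ' Ts (Φ (V₁, z)))) - (Real.log (ρ Ts (Φ (U₁, z))) - Real.log (ρ' Ts (Φ (U₁, z))))) * wNum F γ b₀ p₀ j Ts ρ ρ' Φ J t (X s) z) = fun z => (Real.log (ρ Ts (Φ (V₁, z))) - Real.log (ρ' Ts (Φ (V₁, z)))) * wNum F γ b₀ p₀ j Ts ρ ρ' Φ J t (X s) z - (Real.log (ρ Ts (Φ (U₁, z))) - Real.log (ρ' Ts (Φ (U₁, z)))) * wNum F γ b₀ p₀ j Ts ρ ρ' Φ J t (X s) z := by funext z; ring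
    rw [e]; exact fV.2.2.1.sub fU.2.2.1
  · have e : (fun z => ((Real.log (ρ Ts (Φ (V₁, z))) - Real.log (ρ' Ts (Φ (V₁, z)))) + (Real.log (ρ Ts (Φ (U₁, z))) - Real.log (ρ' Ts (Φ (U₁, z))))) * wNum F γ b₀ p₀ j Ts ρ ρ' Φ J t (X s) z) = fun z => (Real.log (ρ Ts (Φ (V₁, z))) - Real.log (ρ' Ts (Φ (V₁, z)))) * wNum F γ b₀ p₀ j Ts ρ ρ' Φ J t (X s) z + (Real.log (ρ Ts (Φ (U₁, z))) - Real.log (ρ' Ts (Φ (U₁, z)))) * wNum F γ b₀ p₀ j Ts ρ ρ' Φ J t (X s) z := by funext z; ring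
    rw [e]; exact fV.2.2.1.add fU.2.2.1
  · have e : (fun z => (((Real.log (ρ Ts (Φ (V₁, z))) - Real.log (ρ' Ts (Φ (V₁, z)))) - (Real.log (ρ Ts (Φ (U₁, z))) - Real.log (ρ' Ts (Φ (U₁, z))))) * ((Real.log (ρ Ts (Φ (V₁, z))) - Real.log (ρ' Ts (Φ (V₁, z)))) + (Real.log (ρ Ts (Φ (U₁, z))) - Real.log (ρ' Ts (Φ (U₁, z)))))) * wNum F γ b₀ p₀ j Ts ρ ρ' Φ J t (X s) z)
        = fun z => ((Real.log (ρ Ts (Φ (V₁, z))) - Real.log (ρ' Ts (Φ (V₁, z)))) * (Real.log (ρ Ts (Φ (V₁, z))) - Real.log (ρ' Ts (Φ (V₁, z))))) * wNum F γ b₀ p₀ j Ts ρ ρ' Φ J t (X s) z - ((Real.log (ρ Ts (Φ (U₁, z))) - Real.log (ρ' Ts (Φ (U₁, z)))) * (Real.log (ρ Ts (Φ (U₁, z))) - Real.log (ρ' Ts (Φ (U₁, z))))) * wNum F γ b₀ p₀ j Ts ρ ρ' Φ J t (X s) z := by funext z; ring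
    rw [e]; exact fV.2.2.2.sub fU.2.2.2

/-- ★ `hsqpath` of ✓`jv4_of_ilaw` (`F, F²`). [folklore] -/
theorem hsqpath_jv4_of_frame (F : T3Family) (γ b₀ p₀ : ℝ) (j Ts : ℕ) (hjTs : j + 1 ≤ Ts)
    (ρ ρ' : (i : ℕ) → GaugeField (F.P i) 0 ↥(Matrix.specialUnitaryGroup (Fin 2) ℂ) → ℝ)
    (hρm : Measurable (ρ Ts)) (hρ'm : Measurable (ρ' Ts))
    (hρc : ContinuousOn (ρ Ts) {U | PlaqSmall (θBal F.L γ b₀ p₀ Ts) U}) (hρ'c : ContinuousOn (ρ' Ts) {U | PlaqSmall (θBal F.L γ b₀ p₀ Ts) U})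
    (hρpos : ∀ U, PlaqSmall (θBal F.L γ b₀ p₀ Ts) U → 0 < ρ Ts U ∧ 0 < ρ' Ts U)
    (hθ : 0 < θBal F.L γ b₀ p₀ Ts)
    (hχc : Continuous (mwCut F γ b₀ p₀ j Ts)) (hχ0 : ∀ U, 0 ≤ mwCut F γ b₀ p₀ j Ts U)
    (hχsupp : ∀ U, mwCut F γ b₀ p₀ j Ts U ≠ 0 → ∀ (n : ℕ) (hjn : j + 1 ≤ n) (hnK : n ≤ Ts), PlaqSmall (24 / 25 * θBal F.L γ b₀ p₀ n) (descendTo F ℰp n Ts hnK U))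
    (hχpos : ∀ U, (∀ (n : ℕ) (hjn : j + 1 ≤ n) (hnK : n ≤ Ts), PlaqSmall (24 / 25 * θBal F.L γ b₀ p₀ n) (descendTo F ℰp n Ts hnK U)) → 0 < mwCut F γ b₀ p₀ j Ts U)
    {Z : Type} [MeasurableSpace Z] (τ : Measure Z) [IsProbabilityMeasure τ]
    (Φ : GaugeField (F.P j) 0 ↥(Matrix.specialUnitaryGroup (Fin 2) ℂ) × Z → GaugeField (F.P Ts) 0 ↥(Matrix.specialUnitaryGroup (Fin 2) ℂ))
    (J : GaugeField (F.P j) 0 ↥(Matrix.specialUnitaryGroup (Fin 2) ℂ) × Z → ℝ≥0)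
    (hΦm : Measurable Φ) (hJm : Measurable J) (CJ : ℝ) (hJle : ∀ V z, (J (V, z) : ℝ) ≤ CJ)
    (hpos : ∀ V, PlaqSmall (θBal F.L γ b₀ p₀ j) V →
      0 < ∫⁻ z in {z | (∀ (n : ℕ) (hjn : j + 1 ≤ n) (hnK : n ≤ Ts), PlaqSmall (24 / 25 * θBal F.L γ b₀ p₀ n) (descendTo F ℰp n Ts hnK (Φ (V, z))))},
        (J (V, z) : ℝ≥0∞) ∂τ)
    (c : ℝ) (hc : c < 1) (rc : ℝ) (hθj : 0 ≤ θBal F.L γ b₀ p₀ j)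
    (hrc : (1 + 16 * Real.sqrt 3 * rc) * (θBal F.L γ b₀ p₀ j / 4) ≤ θBal F.L γ b₀ p₀ j)
    (hstabW : ∀ (U Xw : GaugeField (F.P j) 0 ↥(Matrix.specialUnitaryGroup (Fin 2) ℂ)), PlaqSmall (θBal F.L γ b₀ p₀ j / 4) U → PlaqSmall (θBal F.L γ b₀ p₀ j) Xw →
      ∀ z, mwCut F γ b₀ p₀ j Ts (Φ (Xw, z)) ≠ 0 → ∀ p, dist1 (GaugeField.plaqHol (Φ (U, z)) p) ≤ c * θBal F.L γ b₀ p₀ Ts) :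
    ∀ (t : ℝ), 0 ≤ t → t ≤ 1 → ∀ (B B' : PBond (F.P j) 0) (m m' : Fin 3 → ℝ) (V00 : GaugeField (F.P j) 0 ↥(Matrix.specialUnitaryGroup (Fin 2) ℂ)) (Y : ℝ → GaugeField (F.P j) 0 ↥(Matrix.specialUnitaryGroup (Fin 2) ℂ)) (X : ℝ → ℝ → GaugeField (F.P j) 0 ↥(Matrix.specialUnitaryGroup (Fin 2) ℂ)), ‖m‖ ≤ rc * (θBal F.L γ b₀ p₀ j / 4) → ‖m'‖ ≤ rc * (θBal F.L γ b₀ p₀ j / 4) →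
      PlaqSmall (θBal F.L γ b₀ p₀ j / 4) V00 → (∀ s e, e ≠ B → Y s e = V00 e) → (∀ s, Y s B = V00 B * expPt (s • m)) → (∀ s s' e, e ≠ B' → X s s' e = Y s e) → (∀ s s', X s s' B' = Y s B' * expPt (s' • m')) →
      ∀ s ∈ Set.Icc (0:ℝ) 1, ∀ s' ∈ Set.Icc (0:ℝ) 1, Integrable (fun z => wNum F γ b₀ p₀ j Ts ρ ρ' Φ J t (X s s') z) τ ∧ Integrable (fun z => (Real.log (ρ Ts (Φ (V00, z))) - Real.log (ρ' Ts (Φ (V00, z)))) * wNum F γ b₀ p₀ j Ts ρ ρ' Φ J t (X s s') z) τ ∧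
        Integrable (fun z => ((Real.log (ρ Ts (Φ (V00, z))) - Real.log (ρ' Ts (Φ (V00, z)))) * (Real.log (ρ Ts (Φ (V00, z))) - Real.log (ρ' Ts (Φ (V00, z))))) * wNum F γ b₀ p₀ j Ts ρ ρ' Φ J t (X s s') z) τ ∧ ∫ z, wNum F γ b₀ p₀ j Ts ρ ρ' Φ J t (X s s') z ∂τ ≠ 0 := by
  intro t _ _ B B' m m' V00 Y X hm hm' hV hYoff hYon hXoff hXon s hs s' hs'
  have hθj4 : 0 ≤ (θBal F.L γ b₀ p₀ j / 4) := by positivity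
  have hXw : PlaqSmall (θBal F.L γ b₀ p₀ j) (X s s') :=
    plaqSmall_mono hrc (plaqSmall_relSquare_of_le hV hm hm' hYoff hYon hXoff hXon (abs_le_two_of_mem_Icc hs) (abs_le_two_of_mem_Icc hs'))
  have f := lawPoint_facts F γ b₀ p₀ j Ts hjTs ρ ρ' hρm hρ'm hρc hρ'c hρpos hθ hχc hχ0 hχsupp hχpos τ Φ J hΦm hJm CJ hJle hpos c hc (hstabW := hstabW) t V00 (X s s') hV hXw
  exact ⟨f.1, f.2.2.1, f.2.2.2, f.2.1⟩

end Summit.QuantumFields.YangMills.Theorems.OrganTangentILawKnitFacts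

end
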